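import Literature.AlgebraicGeometry.Frobenioids.DivSlimRemark
import Literature.AlgebraicGeometry.Frobenioids.OneObjectAutForget
import Mathlib.GroupTheory.Index
import HarnessLib

/-!
# Frobenioids I, Remark 4.12.1: the Frobenius-slim / not Div-slim clauses (proofs)

Mochizuki, *The geometry of Frobenioids I: the general theory*, Kyushu J. Math. **62** (2008)
293–400, kurims text p. 95 [cite: MochizukiFrdI2008, Rem. 4.12.1 p.95]: for the Frobenioid of
Example 3.10 (`C = SingleObj (G × 𝔽) → D = SingleObj G`) with `G` residually finite, the base is "a
Frobenius-slim base category [which is not Div-slim — cf. Remark 4.11.2]".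

PROVED here (partial discharge of the named statement `Rmk4121.Statement` of `DivSlimRemark.lean`, whose
rationally-standard conjunct is a schema over the §4 parameters `R` and is not touched):
* `Rmk4121.isFrobeniusSlim_D` — `G` residually finite ⇒ `D = SingleObj G` is Frobenius-slim
  (Rem. 3.1.2, t3's `isFrobeniusSlim_of_residuallyFinite`, transported along
  `Aut(D_A → D) ≃* G` of `OneObjectAutForget.lean`);
* `Rmk4121.not_isDivSlim` — for `G` non-trivial, `D` is NOT Div-slim relative to the monoid `Φ` of
  Example 3.10 (all pull-backs are identities, so Div-slimness would force `Aut(D_A → D) ≅ G` to be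
  trivial).
-/

namespace Literature.AlgebraicGeometry.Frobenioids

open CategoryTheory

namespace Rmk4121

/-- Residual finiteness is invariant under isomorphism of groups. [cite: MochizukiFrdI2008, Rem. 3.1.2 p.58] -/
theorem isResiduallyFiniteGroup_of_mulEquiv {G H : Type*} [Group G] [Group H] (e : H ≃* G)
    (hG : IsResiduallyFiniteGroup G) : IsResiduallyFiniteGroup H := by
  intro h hh
  have heh : e h ≠ 1 := fun h1 => hh (by simpa using congrArg e.symm h1)
  obtain ⟨N, hN, hfi, hnot⟩ := hG (e h) heh
  haveI := hN
  haveI := hfi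
  refine ⟨N.comap e.toMonoidHom, inferInstance, ?_, fun hm => hnot hm⟩
  constructor
  rw [Subgroup.index_comap_of_surjective _ e.surjective]
  exact hfi.index_ne_zero

variable (G : Type) [Group G]

/-- FrdI Rem. 4.12.1 (with Rem. 3.1.2): if `G` is residually finite, the base category `D = SingleObj G` of
Example 3.10 is Frobenius-slim (PROVED). [cite: MochizukiFrdI2008, Rem. 4.12.1 p.95] -/
theorem isFrobeniusSlim_D (hG : IsResiduallyFiniteGroup G) : IsFrobeniusSlim (Ex310.D G) :=
  isFrobeniusSlim_of_residuallyFinite fun A =>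
    isResiduallyFiniteGroup_of_mulEquiv (SingleObjAut.autForgetMulEquiv G : Aut (Over.forget A) ≃* G) hG

/-- FrdI Rem. 4.12.1 "[which is not Div-slim — cf. Remark 4.11.2]": for `G` non-trivial, the base
`D = SingleObj G` is not Div-slim relative to the monoid `Φ ≡ ℤ_{≥0}` (identity pull-backs) of Example 3.10
(PROVED). [cite: MochizukiFrdI2008, Rem. 4.12.1 p.95] -/
theorem not_isDivSlim [Nontrivial G] : ¬ (Ex310.data G).IsDivSlim := by
  intro h
  obtain ⟨g, hg⟩ := exists_ne (1 : G)
  apply hg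
  let e : Aut (Over.forget (SingleObj.star G)) ≃* G := SingleObjAut.autForgetMulEquiv G
  have hα : e.symm g = 1 := h.eq_one (SingleObj.star G) (e.symm g) fun _ _ => rfl
  rw [← e.apply_symm_apply g, hα, map_one]

end Rmk4121

end Literature.AlgebraicGeometry.Frobenioids
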